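import Literature.NumberTheory.LFunctions.FordProgram1
import HarnessLib

/-!
# Ford's "Program 1": kernel run 11A (`594 ≤ k ≤ 603`)

Topic `Literature/NumberTheory/LFunctions`. Everything here is PROVED (kernel evaluations, standard
axioms): `FordP1.checkT k = true` for `594 ≤ k ≤ 603`, i.e. the certified re-run of PROGRAM 1 of
K. Ford, Proc. LMS 85 (2002) (the second part of Theorem 3) for these `k` — see `FordProgram1.lean`
for the checker, its soundness `FordP1.row_of_checkK`, and the meaning of the constants
(`ρ = FordP1.rhoOf k / 10⁵`, `θ = FordP1.thetaOf k / 10⁴`, `ω = FordP1.omOf k / 10⁴`). One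
`decide +kernel` per `k` (so that the kernel's evaluation state is bounded by a single run;
`maxHeartbeats 0` lifts the deterministic time-out for each), then the range statement
`FordP1.run11A`. The assembly is `FordTheorem3SmallK.lean`.

## References

* K. Ford, Proc. London Math. Soc. (3) 85 (2002), 565–633; arXiv:1910.08209: Theorem 3, (1.7),
  Lemmas 3.4–3.5, Appendix "PROGRAM 1". [Ford2002]
-/

namespace Literature.NumberTheory.LFunctions
namespace FordP1

set_option maxHeartbeats 0 in
/-- `checkT 594`. [cite: Ford2002, Theorem 3 (second part) and PROGRAM 1] -/
theorem checkT_594 : checkT 594 = true := by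
  decide +kernel

set_option maxHeartbeats 0 in
/-- `checkT 595`. [cite: Ford2002, Theorem 3 (second part) and PROGRAM 1] -/
theorem checkT_595 : checkT 595 = true := by
  decide +kernel

set_option maxHeartbeats 0 in
/-- `checkT 596`. [cite: Ford2002, Theorem 3 (second part) and PROGRAM 1] -/
theorem checkT_596 : checkT 596 = true := by
  decide +kernel

set_option maxHeartbeats 0 in
/-- `checkT 597`. [cite: Ford2002, Theorem 3 (second part) and PROGRAM 1] -/
theorem checkT_597 : checkT 597 = true := by
  decide +kernel

set_option maxHeartbeats 0 in
/-- `checkT 598`. [cite: Ford2002, Theorem 3 (second part) and PROGRAM 1] -/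
theorem checkT_598 : checkT 598 = true := by
  decide +kernel

set_option maxHeartbeats 0 in
/-- `checkT 599`. [cite: Ford2002, Theorem 3 (second part) and PROGRAM 1] -/
theorem checkT_599 : checkT 599 = true := by
  decide +kernel

set_option maxHeartbeats 0 in
/-- `checkT 600`. [cite: Ford2002, Theorem 3 (second part) and PROGRAM 1] -/
theorem checkT_600 : checkT 600 = true := by
  decide +kernel

set_option maxHeartbeats 0 in
/-- `checkT 601`. [cite: Ford2002, Theorem 3 (second part) and PROGRAM 1] -/
theorem checkT_601 : checkT 601 = true := by
  decide +kernel

set_option maxHeartbeats 0 in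
/-- `checkT 602`. [cite: Ford2002, Theorem 3 (second part) and PROGRAM 1] -/
theorem checkT_602 : checkT 602 = true := by
  decide +kernel

set_option maxHeartbeats 0 in
/-- `checkT 603`. [cite: Ford2002, Theorem 3 (second part) and PROGRAM 1] -/
theorem checkT_603 : checkT 603 = true := by
  decide +kernel

/-- **Kernel run 11A**: `checkT k` for `594 ≤ k ≤ 603`. [cite: Ford2002, Theorem 3 (second part)
and PROGRAM 1] -/
theorem run11A (k : ℕ) (h1 : 594 ≤ k) (h2 : k ≤ 603) : checkT k = true := by
  interval_cases k
  · exact checkT_594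
  · exact checkT_595
  · exact checkT_596
  · exact checkT_597
  · exact checkT_598
  · exact checkT_599
  · exact checkT_600
  · exact checkT_601
  · exact checkT_602
  · exact checkT_603

end FordP1
end Literature.NumberTheory.LFunctions
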